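import Summits.ResolutionOfSingularities.ResolutionOfSingularities.Theorems.HomologicalConductorNoZenoThreadGerm
import HarnessLib

/-!
# Crux `NoZenoR` / `NoZeno` (stmt-ResolutionOfSingularities-19943 / -16483), β layer:
# T-TOWER — the surface tower of a singular prime thread, as ONE statement

Route `ResolutionOfSingularities/HomologicalConductor`.  OURS (cell res-hironaka, chain W4.4); nothing here is a
statement of the manuscript under review, and nothing here asserts a Theses declaration.  Fourth file of the thread
dictionary (T-SURF p518180, T-STEP p519967, T-GERM p521139): for a `Parasite.SingularPrimeThread`-shaped datum
`P = (P_m)` on a tower whose normalised stages have Krull dimension `3`, from the escape stage on EVERY germ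
`D_(n+1) = (T_(n+1))_(P_(n+1))` is a two-dimensional normal local domain with isolated (non-regular) singularity,
`I_(n+1) = ca(T_(n+1))·D_(n+1)` is `𝔪`-primary and `≤ ca(D_(n+1))`, admissible denominators exist, `D_(n+1) ≤ D_(n+2)`,
and for every admissible `x` the next germ `D_(n+2)` is the local ring of the normalised blow-up of `D_(n+1)` along
`I_(n+1)` at the point under `P_(n+2)`, with `I_(n+1)·D_(n+2) = x·D_(n+2)` — the literal «surface tower along the
thread» of CHAIN W4.4 v12 §3.3 / skeleton v23 β2, obtained by `intro` from `SingularPrimeThread`.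

* `exists_admissible_tower` — every stage `T_m` has an admissible denominator (`ca(T_m) ≠ 0`: the zero ideal has
  regular localisation `K`, Iyengar–Takahashi 5.4; then `di_exists_admissible`);
* `not_mem_thread_of_le` — the escaping element stays outside the thread primes at all later stages;
* **`threadTower`** — the package.
-/

noncomputable section

-- single-problem summit: the doubled namespace component `ResolutionOfSingularities` is forced
set_option linter.dupNamespace false

namespace Summit.ResolutionOfSingularities.ResolutionOfSingularities.Theorems.NoZeno.SandwichCluster.Thread

open IsLocalRing
open Summit.ResolutionOfSingularities.ResolutionOfSingularities.Theses.HomologicalConductor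
open Summit.ResolutionOfSingularities.ResolutionOfSingularities.Theorems.NoZeno.Birth
open Parasite (locPrime mem_locPrime_of_mem inv_mem_locPrime_of_not_mem)
open Literature.RingTheory.CohomologyAnnihilator (cohomologyAnnihilator IsIsolatedSingularity)

variable {k K : Type} [Field k] [Field K] [Algebra k K]

/-- **Every stage has an admissible denominator**: some nonzero `x ∈ ca(T_m)` has minimal `O`-value on
`ca(T_m)`.  (`ca(T_m) ≠ 0` because the localisation of the domain `T_m` at the zero ideal — a field — is
regular, so `ca(T_m) ⊄ (0)` by Iyengar–Takahashi 5.4; then `di_exists_admissible`.)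
[cite: IyengarTakahashi2014, Thm. 5.4] -/
theorem exists_admissible_tower (O : ValuationSubring K) (A : Subalgebra k K)
    (hk : ∀ c : k, algebraMap k K c ∈ O) (hA : A.FG) (hfr : IsFractionRing ↥A K)
    (hAO : A.toSubring ≤ O.toSubring) (m : ℕ) :
    ∃ x ∈ ca (tower O A m), x ≠ 0 ∧ ∀ c ∈ ca (tower O A m), c * x⁻¹ ∈ O := by
  haveI := hfr
  haveI : IsNoetherianRing ↥(tower O A m) := stub_towerNoetherian k K O A hk hA hfr hAO m
  obtain ⟨-, -, hET⟩ := tn_tower_invariant O A hk hA hfr hAO m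
  haveI := hET
  -- the zero ideal has regular (field) localisation, hence does not contain `ca`
  haveI : (⊥ : Ideal ↥(tower O A m)).IsPrime := Ideal.isPrime_bot
  have hreg : IsRegularLocalRing (Localization.AtPrime (⊥ : Ideal ↥(tower O A m))) := by
    refine Literature.AlgebraicGeometry.Resolution.isRegularLocalRing_of_isField ?_
    rw [IsLocalRing.isField_iff_maximalIdeal_eq, ← Localization.AtPrime.map_eq_maximalIdeal,
      Ideal.map_bot]
  have hnot : ¬ cohomologyAnnihilator ↥(tower O A m) ≤ ⊥ := fun h =>
    (cohomologyAnnihilator_le_iff_not_isRegularLocalRing k ↥(tower O A m) ⊥).mp h hreg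
  obtain ⟨g, hg, hg0⟩ : ∃ g ∈ cohomologyAnnihilator ↥(tower O A m), g ≠ 0 := by
    by_contra! hcon
    exact hnot fun g hg => (Ideal.mem_bot).mpr (hcon g hg)
  have hgK : (g : K) ∈ ca (tower O A m) := (tn_coe_mem_ca_iff _ g).mpr hg
  have hg0K : (g : K) ≠ 0 := fun h => hg0 (Subtype.ext h)
  exact di_exists_admissible O (tower O A m)
    (fun b hb => mem_valuationSubring_of_mem_tower O hk hAO m b hb) hgK hg0K

/-- Along a thread (compatible primes), an element of `T_m` outside `P_m` stays outside `P_n` for every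
`n ≥ m`. [this work] -/
theorem not_mem_thread_of_le (O : ValuationSubring K) (A : Subalgebra k K)
    (P : ∀ m : ℕ, Ideal ↥(tower O A m))
    (hcompat : ∀ (m : ℕ) (x : K) (hx : x ∈ tower O A m) (hx' : x ∈ tower O A (m + 1)),
      (⟨x, hx'⟩ : ↥(tower O A (m + 1))) ∈ P (m + 1) ↔ (⟨x, hx⟩ : ↥(tower O A m)) ∈ P m)
    {m : ℕ} {s : K} (hs : s ∈ tower O A m) (hsP : (⟨s, hs⟩ : ↥(tower O A m)) ∉ P m)
    {n : ℕ} (hmn : m ≤ n) (hs' : s ∈ tower O A n) : (⟨s, hs'⟩ : ↥(tower O A n)) ∉ P n := by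
  induction hmn with
  | refl => exact hsP
  | @step n hmn ih =>
    have hsn : s ∈ tower O A n := d2rc_mem_tower_of_le O A hmn hs
    exact fun h => ih hsn ((hcompat n s hsn hs').mp h)

/-- **T-TOWER — the surface tower of a singular prime thread.**  Let the normalised stages `T_(n+1)` have
Krull dimension `3`, and let `P = (P_m)` be primes of the stages, compatible (`x ∈ P_(m+1) ↔ x ∈ P_m` on
`T_m`), containing the elements of `ca(T_m)`, with an escaping element (`s ∈ T_(m_e)`, `O`-value `< 1`,
`s ∉ P_(m_e)`) — the data of `Parasite.SingularPrimeThread` minus its (here unused) non-triviality clause.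
Then for every `n ≥ m_e`, writing `D_j := Parasite.locPrime (T_j) (P_j)` and
`I_j := Ideal.span {d ∈ D_j | d ∈ ca T_j}`:
(germ) `dim D_(n+1) = 2`, `D_(n+1)` integrally closed, not regular, an isolated singularity, `√I_(n+1) = 𝔪`,
`I_(n+1)` primary, `I_(n+1) ≤ ca(D_(n+1))` (T-GERM);
(chain) `D_(n+1) ≤ D_(n+2)`;
(denominators) admissible `x ∈ ca(T_(n+1))` exist;
(step) for EVERY admissible `x` and `B = k[D_(n+1) ∪ ca(T_(n+1))·x⁻¹]`: `nrm B ≤ D_(n+2)`, `I_(n+1)·D_(n+2) = x·D_(n+2)`,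
and `(nrm B)_𝔮 = D_(n+2)` for the prime `𝔮` of non-units of `D_(n+2)` (T-STEP).  [this work] -/
theorem threadTower (O : ValuationSubring K) (A : Subalgebra k K)
    (hk : ∀ c : k, algebraMap k K c ∈ O) (hA : A.FG) (hfr : IsFractionRing ↥A K)
    (hAO : A.toSubring ≤ O.toSubring) (hdim : ∀ n : ℕ, ringKrullDim ↥(tower O A (n + 1)) = 3)
    (P : ∀ m : ℕ, Ideal ↥(tower O A m)) (hP : ∀ m, (P m).IsPrime)
    (hcompat : ∀ (m : ℕ) (x : K) (hx : x ∈ tower O A m) (hx' : x ∈ tower O A (m + 1)),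
      (⟨x, hx'⟩ : ↥(tower O A (m + 1))) ∈ P (m + 1) ↔ (⟨x, hx⟩ : ↥(tower O A m)) ∈ P m)
    (hca : ∀ (m : ℕ) (x : K) (hx : x ∈ tower O A m),
      x ∈ ca (tower O A m) → (⟨x, hx⟩ : ↥(tower O A m)) ∈ P m)
    (hesc : ∃ (m : ℕ) (s : K) (hs : s ∈ tower O A m),
      O.valuation s < 1 ∧ (⟨s, hs⟩ : ↥(tower O A m)) ∉ P m) :
    ∃ m₀ : ℕ, ∀ n : ℕ, m₀ ≤ n →
      (ringKrullDim ↥(locPrime (tower O A (n + 1)) (P (n + 1)) (hP (n + 1))) = 2 ∧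
        IsIntegrallyClosed ↥(locPrime (tower O A (n + 1)) (P (n + 1)) (hP (n + 1))) ∧
        ¬ IsRegularLocalRing ↥(locPrime (tower O A (n + 1)) (P (n + 1)) (hP (n + 1))) ∧
        @IsIsolatedSingularity ↥(locPrime (tower O A (n + 1)) (P (n + 1)) (hP (n + 1))) _
          (Parasite.isLocalRing_locPrime (tower O A (n + 1)) (P (n + 1)) (hP (n + 1))) ∧
        (Ideal.span {d : ↥(locPrime (tower O A (n + 1)) (P (n + 1)) (hP (n + 1))) |
            (d : K) ∈ ca (tower O A (n + 1))}).radical =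
          @maximalIdeal ↥(locPrime (tower O A (n + 1)) (P (n + 1)) (hP (n + 1))) _
            (Parasite.isLocalRing_locPrime (tower O A (n + 1)) (P (n + 1)) (hP (n + 1))) ∧
        (Ideal.span {d : ↥(locPrime (tower O A (n + 1)) (P (n + 1)) (hP (n + 1))) |
            (d : K) ∈ ca (tower O A (n + 1))}).IsPrimary ∧
        Ideal.span {d : ↥(locPrime (tower O A (n + 1)) (P (n + 1)) (hP (n + 1))) |
            (d : K) ∈ ca (tower O A (n + 1))} ≤
          cohomologyAnnihilator ↥(locPrime (tower O A (n + 1)) (P (n + 1)) (hP (n + 1)))) ∧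
      ((locPrime (tower O A (n + 1)) (P (n + 1)) (hP (n + 1)) : Set K) ⊆
        locPrime (tower O A (n + 1 + 1)) (P (n + 1 + 1)) (hP (n + 1 + 1))) ∧
      (∃ x ∈ ca (tower O A (n + 1)), x ≠ 0 ∧ ∀ c ∈ ca (tower O A (n + 1)), c * x⁻¹ ∈ O) ∧
      (∀ (x : K), x ∈ ca (tower O A (n + 1)) → x ≠ 0 → (∀ c ∈ ca (tower O A (n + 1)), c * x⁻¹ ∈ O) →
        ∀ (B : Subalgebra k K),
          B = Algebra.adjoin k ((locPrime (tower O A (n + 1)) (P (n + 1)) (hP (n + 1)) : Set K) ∪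
            {y : K | ∃ c ∈ ca (tower O A (n + 1)), y = c * x⁻¹}) →
          (nrm B : Set K) ⊆ locPrime (tower O A (n + 1 + 1)) (P (n + 1 + 1)) (hP (n + 1 + 1)) ∧
          (∀ hxD : x ∈ locPrime (tower O A (n + 1 + 1)) (P (n + 1 + 1)) (hP (n + 1 + 1)),
            Ideal.span {d : ↥(locPrime (tower O A (n + 1 + 1)) (P (n + 1 + 1)) (hP (n + 1 + 1))) |
                (d : K) ∈ ca (tower O A (n + 1))} = Ideal.span {⟨x, hxD⟩}) ∧
          ∃ (𝔮 : Ideal ↥(nrm B)) (h𝔮 : 𝔮.IsPrime),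
            locPrime (nrm B) 𝔮 h𝔮 = locPrime (tower O A (n + 1 + 1)) (P (n + 1 + 1)) (hP (n + 1 + 1)) ∧
            ∀ b : ↥(nrm B), b ∉ 𝔮 ↔ ((b : K) ≠ 0 ∧
              (b : K)⁻¹ ∈ locPrime (tower O A (n + 1 + 1)) (P (n + 1 + 1)) (hP (n + 1 + 1)))) := by
  obtain ⟨mₑ, s, hs, hvs, hsP⟩ := hesc
  refine ⟨mₑ, fun n hn => ?_⟩
  have hcompat' : ∀ (m : ℕ) (x : K) (hx : x ∈ tower O A m) (hx' : x ∈ tower O A (m + 1)),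
      (⟨x, hx'⟩ : ↥(tower O A (m + 1))) ∈ P (m + 1) → (⟨x, hx⟩ : ↥(tower O A m)) ∈ P m :=
    fun m x hx hx' => (hcompat m x hx hx').mp
  -- the escaping element at stage `n + 1`
  have hsn : s ∈ tower O A (n + 1) := d2rc_mem_tower_of_le O A (hn.trans (Nat.le_succ n)) hs
  have hsPn : (⟨s, hsn⟩ : ↥(tower O A (n + 1))) ∉ P (n + 1) :=
    not_mem_thread_of_le O A P hcompat hs hsP (hn.trans (Nat.le_succ n)) hsn
  have hs' : ∃ (s : K) (hs : s ∈ tower O A (n + 1)), O.valuation s < 1 ∧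
      (⟨s, hs⟩ : ↥(tower O A (n + 1))) ∉ P (n + 1) := ⟨s, hsn, hvs, hsPn⟩
  refine ⟨threadGerm O A hk hA hfr hAO n (hdim n) (P (n + 1)) (hP (n + 1)) (hca (n + 1)) hs',
    locPrime_le_locPrime_succ O A (n + 1) (P (n + 1)) (hP (n + 1)) (P (n + 1 + 1)) (hP (n + 1 + 1))
      (hcompat' (n + 1)),
    exists_admissible_tower O A hk hA hfr hAO (n + 1), ?_⟩
  intro x hxca hx0 hxmin B hB
  exact ⟨nrm_adjoin_locPrime_le_locPrime_succ O A hk hA hfr hAO (n + 1) (P (n + 1)) (hP (n + 1))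
      (P (n + 1 + 1)) (hP (n + 1 + 1)) (hcompat' (n + 1)) hxca hx0 hxmin B hB,
    fun hxD => span_ca_eq_span_singleton O A (n + 1) (P (n + 1 + 1)) (hP (n + 1 + 1)) hxca hx0 hxmin hxD,
    locPrime_succ_eq_locPrime_nrm_adjoin O A hk hA hfr hAO (n + 1) (P (n + 1)) (hP (n + 1))
      (P (n + 1 + 1)) (hP (n + 1 + 1)) (hcompat' (n + 1)) hxca hx0 hxmin B hB⟩

/-! ## Appendix (stub-2 g10, after p522500): the stage dimension is FORCED along a thread in tr.deg 3 -/

/-- In `ℕ∞`: `2 < a ≤ 3` gives `a = 3`. [folklore] -/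
private theorem enat_eq_three_of_lt_of_le {a : ℕ∞} (h2 : 2 < a) (h3 : a ≤ 3) : a = 3 := by
  induction a using ENat.recTopCoe with
  | top => simp at h3
  | coe a =>
    have h2' : 2 < a := by exact_mod_cast h2
    have h3' : a ≤ 3 := by exact_mod_cast h3
    exact_mod_cast (show a = 3 by omega)

/-- **Along a thread the stage dimension is forced**: in transcendence degree `3`, a normalised stage
`T_(n+1)` carrying a prime `P ⊇ ca`-elements with an element of `O`-value `< 1` outside it has Krull dimension
EXACTLY `3` — `≤ 3` by `dim ≤ tr.deg` (`d2rc_ringKrullDim_tower_le`), `≥ 3` because `T_P` is singular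
(Iyengar–Takahashi 5.4), hence `height P ≥ 2` by `R₁`, and `P ⊊ 𝔪`.  So the `hdim` binder of `threadGerm` /
`threadTower` is dischargeable from `Algebra.trdeg k K = 3` alone in the thread setting (no zero-dimensionality
of `O` needed). [this work] -/
theorem ringKrullDim_tower_succ_eq_three_of_thread (O : ValuationSubring K) (A : Subalgebra k K)
    (hk : ∀ c : k, algebraMap k K c ∈ O) (hA : A.FG) (hfr : IsFractionRing ↥A K)
    (hAO : A.toSubring ≤ O.toSubring) (htr : Algebra.trdeg k K = 3) (n : ℕ)
    (P : Ideal ↥(tower O A (n + 1))) [P.IsPrime]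
    (hca : ∀ (x : K) (hx : x ∈ tower O A (n + 1)), x ∈ ca (tower O A (n + 1)) →
      (⟨x, hx⟩ : ↥(tower O A (n + 1))) ∈ P)
    (hs : ∃ (s : K) (hs : s ∈ tower O A (n + 1)), O.valuation s < 1 ∧
      (⟨s, hs⟩ : ↥(tower O A (n + 1))) ∉ P) :
    ringKrullDim ↥(tower O A (n + 1)) = 3 := by
  haveI := hfr
  haveI : IsNoetherianRing ↥(tower O A (n + 1)) := stub_towerNoetherian k K O A hk hA hfr hAO (n + 1)
  haveI : IsIntegrallyClosed ↥(tower O A (n + 1)) := d2rc_isIntegrallyClosed_tower_succ O A hk hA hfr hAO n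
  haveI : IsLocalRing ↥(tower O A (n + 1)) := by
    obtain ⟨B, hBO, hTB⟩ := exists_tower_eq_loc O A hk hAO (n + 1)
    rw [hTB, loc_eq_locAt]
    exact SyzygyFlattening.isLocalRing_locAt O B hBO
  obtain ⟨-, -, hET⟩ := tn_tower_invariant O A hk hA hfr hAO (n + 1)
  haveI := hET
  obtain ⟨s, hsT, hvs, hsP⟩ := hs
  have hP : P ≠ maximalIdeal ↥(tower O A (n + 1)) :=
    ne_maximalIdeal_of_valuation_lt_one O A hk hAO (n + 1) P hsT hvs hsP
  have hca' : cohomologyAnnihilator ↥(tower O A (n + 1)) ≤ P := fun x hx => by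
    simpa using hca x x.2 ((tn_coe_mem_ca_iff (tower O A (n + 1)) x).mpr hx)
  have hsing : ¬ IsRegularLocalRing (Localization.AtPrime P) :=
    (cohomologyAnnihilator_le_iff_not_isRegularLocalRing k ↥(tower O A (n + 1)) P).mp hca'
  have h2 : 2 ≤ P.height := two_le_height_of_not_isRegularLocalRing P hsing
  have hlt : P.height < (maximalIdeal ↥(tower O A (n + 1))).height := height_lt_height_maximalIdeal P hP
  have hle3 : ringKrullDim ↥(tower O A (n + 1)) ≤ 3 := by
    exact_mod_cast d2rc_ringKrullDim_tower_le O A (n + 1) htr.le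
  have hm : (maximalIdeal ↥(tower O A (n + 1))).height = 3 := by
    have hle' : (maximalIdeal ↥(tower O A (n + 1))).height ≤ 3 := by
      rw [← IsLocalRing.maximalIdeal_height_eq_ringKrullDim] at hle3
      rwa [← WithBot.coe_ofNat, WithBot.coe_le_coe] at hle3
    exact enat_eq_three_of_lt_of_le (lt_of_le_of_lt h2 hlt) hle'
  rw [← IsLocalRing.maximalIdeal_height_eq_ringKrullDim, hm]
  rfl

/-- **T-GERM from `tr.deg = 3`** (the `hdim` binder discharged by `ringKrullDim_tower_succ_eq_three_of_thread`).
[this work] -/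
theorem threadGerm_of_trdeg (O : ValuationSubring K) (A : Subalgebra k K)
    (hk : ∀ c : k, algebraMap k K c ∈ O) (hA : A.FG) (hfr : IsFractionRing ↥A K)
    (hAO : A.toSubring ≤ O.toSubring) (htr : Algebra.trdeg k K = 3) (n : ℕ)
    (P : Ideal ↥(tower O A (n + 1))) (hP : P.IsPrime)
    (hca : ∀ (x : K) (hx : x ∈ tower O A (n + 1)), x ∈ ca (tower O A (n + 1)) →
      (⟨x, hx⟩ : ↥(tower O A (n + 1))) ∈ P)
    (hs : ∃ (s : K) (hs : s ∈ tower O A (n + 1)), O.valuation s < 1 ∧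
      (⟨s, hs⟩ : ↥(tower O A (n + 1))) ∉ P) :
    ringKrullDim ↥(locPrime (tower O A (n + 1)) P hP) = 2 ∧
      IsIntegrallyClosed ↥(locPrime (tower O A (n + 1)) P hP) ∧
      ¬ IsRegularLocalRing ↥(locPrime (tower O A (n + 1)) P hP) ∧
      @IsIsolatedSingularity ↥(locPrime (tower O A (n + 1)) P hP) _
        (Parasite.isLocalRing_locPrime (tower O A (n + 1)) P hP) ∧
      (Ideal.span {d : ↥(locPrime (tower O A (n + 1)) P hP) | (d : K) ∈ ca (tower O A (n + 1))}).radical =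
        @maximalIdeal ↥(locPrime (tower O A (n + 1)) P hP) _
          (Parasite.isLocalRing_locPrime (tower O A (n + 1)) P hP) ∧
      (Ideal.span {d : ↥(locPrime (tower O A (n + 1)) P hP) | (d : K) ∈ ca (tower O A (n + 1))}).IsPrimary ∧
      Ideal.span {d : ↥(locPrime (tower O A (n + 1)) P hP) | (d : K) ∈ ca (tower O A (n + 1))} ≤
        cohomologyAnnihilator ↥(locPrime (tower O A (n + 1)) P hP) := by
  haveI := hP
  exact threadGerm O A hk hA hfr hAO n
    (ringKrullDim_tower_succ_eq_three_of_thread O A hk hA hfr hAO htr n P hca hs) P hP hca hs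

/-- **T-TOWER from `tr.deg = 3`** — `threadTower` with the stage-dimension binder replaced by
`Algebra.trdeg k K = 3` (the β2(n=3) setting): along the thread the dimension is forced at every stage past the
escape stage. [this work] -/
theorem threadTower_of_trdeg (O : ValuationSubring K) (A : Subalgebra k K)
    (hk : ∀ c : k, algebraMap k K c ∈ O) (hA : A.FG) (hfr : IsFractionRing ↥A K)
    (hAO : A.toSubring ≤ O.toSubring) (htr : Algebra.trdeg k K = 3)
    (P : ∀ m : ℕ, Ideal ↥(tower O A m)) (hP : ∀ m, (P m).IsPrime)
    (hcompat : ∀ (m : ℕ) (x : K) (hx : x ∈ tower O A m) (hx' : x ∈ tower O A (m + 1)),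
      (⟨x, hx'⟩ : ↥(tower O A (m + 1))) ∈ P (m + 1) ↔ (⟨x, hx⟩ : ↥(tower O A m)) ∈ P m)
    (hca : ∀ (m : ℕ) (x : K) (hx : x ∈ tower O A m),
      x ∈ ca (tower O A m) → (⟨x, hx⟩ : ↥(tower O A m)) ∈ P m)
    (hesc : ∃ (m : ℕ) (s : K) (hs : s ∈ tower O A m),
      O.valuation s < 1 ∧ (⟨s, hs⟩ : ↥(tower O A m)) ∉ P m) :
    ∃ m₀ : ℕ, ∀ n : ℕ, m₀ ≤ n →
      ringKrullDim ↥(tower O A (n + 1)) = 3 ∧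
      (ringKrullDim ↥(locPrime (tower O A (n + 1)) (P (n + 1)) (hP (n + 1))) = 2 ∧
        IsIntegrallyClosed ↥(locPrime (tower O A (n + 1)) (P (n + 1)) (hP (n + 1))) ∧
        ¬ IsRegularLocalRing ↥(locPrime (tower O A (n + 1)) (P (n + 1)) (hP (n + 1))) ∧
        @IsIsolatedSingularity ↥(locPrime (tower O A (n + 1)) (P (n + 1)) (hP (n + 1))) _
          (Parasite.isLocalRing_locPrime (tower O A (n + 1)) (P (n + 1)) (hP (n + 1))) ∧
        (Ideal.span {d : ↥(locPrime (tower O A (n + 1)) (P (n + 1)) (hP (n + 1))) |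
            (d : K) ∈ ca (tower O A (n + 1))}).radical =
          @maximalIdeal ↥(locPrime (tower O A (n + 1)) (P (n + 1)) (hP (n + 1))) _
            (Parasite.isLocalRing_locPrime (tower O A (n + 1)) (P (n + 1)) (hP (n + 1))) ∧
        (Ideal.span {d : ↥(locPrime (tower O A (n + 1)) (P (n + 1)) (hP (n + 1))) |
            (d : K) ∈ ca (tower O A (n + 1))}).IsPrimary ∧
        Ideal.span {d : ↥(locPrime (tower O A (n + 1)) (P (n + 1)) (hP (n + 1))) |
            (d : K) ∈ ca (tower O A (n + 1))} ≤
          cohomologyAnnihilator ↥(locPrime (tower O A (n + 1)) (P (n + 1)) (hP (n + 1)))) ∧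
      ((locPrime (tower O A (n + 1)) (P (n + 1)) (hP (n + 1)) : Set K) ⊆
        locPrime (tower O A (n + 1 + 1)) (P (n + 1 + 1)) (hP (n + 1 + 1))) ∧
      (∃ x ∈ ca (tower O A (n + 1)), x ≠ 0 ∧ ∀ c ∈ ca (tower O A (n + 1)), c * x⁻¹ ∈ O) ∧
      (∀ (x : K), x ∈ ca (tower O A (n + 1)) → x ≠ 0 → (∀ c ∈ ca (tower O A (n + 1)), c * x⁻¹ ∈ O) →
        ∀ (B : Subalgebra k K),
          B = Algebra.adjoin k ((locPrime (tower O A (n + 1)) (P (n + 1)) (hP (n + 1)) : Set K) ∪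
            {y : K | ∃ c ∈ ca (tower O A (n + 1)), y = c * x⁻¹}) →
          (nrm B : Set K) ⊆ locPrime (tower O A (n + 1 + 1)) (P (n + 1 + 1)) (hP (n + 1 + 1)) ∧
          (∀ hxD : x ∈ locPrime (tower O A (n + 1 + 1)) (P (n + 1 + 1)) (hP (n + 1 + 1)),
            Ideal.span {d : ↥(locPrime (tower O A (n + 1 + 1)) (P (n + 1 + 1)) (hP (n + 1 + 1))) |
                (d : K) ∈ ca (tower O A (n + 1))} = Ideal.span {⟨x, hxD⟩}) ∧
          ∃ (𝔮 : Ideal ↥(nrm B)) (h𝔮 : 𝔮.IsPrime),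
            locPrime (nrm B) 𝔮 h𝔮 = locPrime (tower O A (n + 1 + 1)) (P (n + 1 + 1)) (hP (n + 1 + 1)) ∧
            ∀ b : ↥(nrm B), b ∉ 𝔮 ↔ ((b : K) ≠ 0 ∧
              (b : K)⁻¹ ∈ locPrime (tower O A (n + 1 + 1)) (P (n + 1 + 1)) (hP (n + 1 + 1)))) := by
  obtain ⟨mₑ, s, hs, hvs, hsP⟩ := hesc
  refine ⟨mₑ, fun n hn => ?_⟩
  have hcompat' : ∀ (m : ℕ) (x : K) (hx : x ∈ tower O A m) (hx' : x ∈ tower O A (m + 1)),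
      (⟨x, hx'⟩ : ↥(tower O A (m + 1))) ∈ P (m + 1) → (⟨x, hx⟩ : ↥(tower O A m)) ∈ P m :=
    fun m x hx hx' => (hcompat m x hx hx').mp
  have hsn : s ∈ tower O A (n + 1) := d2rc_mem_tower_of_le O A (hn.trans (Nat.le_succ n)) hs
  have hsPn : (⟨s, hsn⟩ : ↥(tower O A (n + 1))) ∉ P (n + 1) :=
    not_mem_thread_of_le O A P hcompat hs hsP (hn.trans (Nat.le_succ n)) hsn
  have hs' : ∃ (s : K) (hs : s ∈ tower O A (n + 1)), O.valuation s < 1 ∧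
      (⟨s, hs⟩ : ↥(tower O A (n + 1))) ∉ P (n + 1) := ⟨s, hsn, hvs, hsPn⟩
  haveI := hP (n + 1)
  have hdimn : ringKrullDim ↥(tower O A (n + 1)) = 3 :=
    ringKrullDim_tower_succ_eq_three_of_thread O A hk hA hfr hAO htr n (P (n + 1)) (hca (n + 1)) hs'
  refine ⟨hdimn, threadGerm O A hk hA hfr hAO n hdimn (P (n + 1)) (hP (n + 1)) (hca (n + 1)) hs',
    locPrime_le_locPrime_succ O A (n + 1) (P (n + 1)) (hP (n + 1)) (P (n + 1 + 1)) (hP (n + 1 + 1))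
      (hcompat' (n + 1)),
    exists_admissible_tower O A hk hA hfr hAO (n + 1), ?_⟩
  intro x hxca hx0 hxmin B hB
  exact ⟨nrm_adjoin_locPrime_le_locPrime_succ O A hk hA hfr hAO (n + 1) (P (n + 1)) (hP (n + 1))
      (P (n + 1 + 1)) (hP (n + 1 + 1)) (hcompat' (n + 1)) hxca hx0 hxmin B hB,
    fun hxD => span_ca_eq_span_singleton O A (n + 1) (P (n + 1 + 1)) (hP (n + 1 + 1)) hxca hx0 hxmin hxD,
    locPrime_succ_eq_locPrime_nrm_adjoin O A hk hA hfr hAO (n + 1) (P (n + 1)) (hP (n + 1))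
      (P (n + 1 + 1)) (hP (n + 1 + 1)) (hcompat' (n + 1)) hxca hx0 hxmin B hB⟩

end Summit.ResolutionOfSingularities.ResolutionOfSingularities.Theorems.NoZeno.SandwichCluster.Thread

end
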